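import Literature.Computability.AlgebraicComplexity.LMR13DualSchemeDetProofs
import Literature.Computability.AlgebraicComplexity.LMR13SubspaceVarietyClosed
import Literature.Computability.AlgebraicComplexity.LMR13SubspaceTangentExcess
import Literature.Computability.AlgebraicComplexity.OrbitClosureIrreducible
import Literature.RingTheory.MvPolynomial.BinaryFormLinearFactors
import Mathlib.LinearAlgebra.FiniteDimensional.Lemmas
import HarnessLib

/-!
# LMR 2013, Prop. 4.1.1 (i) as printed is FALSE at `k = 0`: `Sub₂(S³ℂ³) ⊊ Δ[x₀x₁x₂] ⊆ 𝒟ual_{0,3,3}`,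
# so `Sub₂(S³ℂ³)` is not an irreducible component of `𝒟ual_{0,3,3}`

Cell val-lit (D-0074), row LMR13-A; lead-lmr g3 RULING/FINDING 2026-08-26T12:01:08Z (3) (erratum
candidate `LMR2013_prop_4_1_1`, route (i), GO to this seat) and 12:44:19Z (6) (second, independent
certificate). Companion of `LMR13DualVarieties.lean`, where Landsberg–Manivel–Ressayre 2013,
Prop. 4.1.1 (Comment. Math. Helv. 88, p. 482 = arXiv 1004.4802 Prop. 4.0.3: "`Sub_{k+2}(S^d ℂ^N)` is
a reduced, irreducible component of `𝒟ual_{k,d,N}`", scope `d ≥ 3`, `k + 3 ≤ N`) is the named fact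
`LMR2013_prop_4_1_1`, typed VERBATIM; conjunct (i) reads
`IsCoeffIrreducibleComponent (subspaceVariety σ ℂ (k+2) d) (lmrDualScheme k d)`. The FIRST kernel
refutation, through conjunct (ii) (reducedness fails along `Sub₂(S³ℂ³)` at every point), is
`not_LMR2013_prop_4_1_1` (`LMR13SubspaceTangentExcess.lean`, p445925 @ 753f9039c247). This file
refutes conjunct (i) on its own, at `(k, d, N) = (0, 3, 3)` (inside the typed scope: `3 ≤ 3`,
`0 + 3 ≤ |Fin 3|`).

## Result

* `orbitClosure_X012_subset_lmrDualScheme` : `Δ[x₀x₁x₂] ⊆ 𝒟ual_{0,3,3}` — `det Hess(x₀x₁x₂) =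
  2·x₀x₁x₂` (`det_hessPoly_X012`), so for every `g` and every `3`-frame `B`,
  `det(B·H_{g·P}·Bᵀ) = g·(det(Bg)²·2·P)` is divisible by `g·P` (`hessGenMinor_linSubst`,
  `hessGenMinor_mul_mul`), whence all equations (2) vanish (`lmrDualEquation_eq_zero_of_dvd`,
  LMR §2.1–2.3: "the polynomial `P` must divide `det(H_P|_F)`"), and `𝒟ual` is Zariski closed
  (`coeffZariskiClosure_subset_lmrDualScheme`).
* `subspaceVariety_two_three_subset_orbitClosure_X012` : `Sub₂(S³ℂ³) ⊆ Δ[x₀x₁x₂]` — a point of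
  `Sub₂` is `A·Q(x,y)` with `Q` a binary cubic (`exists_linSubst_rename_of_mem_subspaceVariety`,
  from the (ii)-file), a binary cubic is a product of three linear forms (Gibson 1998 Lemma 3.14,
  `Literature.RingTheory.MvPolynomial.exists_prod_linear_of_isHomogeneous`), and a product of three
  linear forms `m₁m₂m₃ = N·(x₀x₁x₂)` lies in `End(ℂ³)·x₀x₁x₂ ⊆ Δ[x₀x₁x₂]`
  (`endOrbit_subset_orbitClosure_holds`).
* `X012_not_mem_subspaceVariety_two` : `x₀x₁x₂ ∉ Sub₂(S³ℂ³)` — its partials `x₁x₂, x₀x₂, x₀x₁` are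
  linearly independent, rank `3 > 2` (`finrank_span_pderiv_le_of_mem_subspaceVariety`, Landsberg 2017
  §6.2.2).
* `not_isCoeffIrreducibleComponent_subspaceVariety_two_three` : with `S′ = Δ[x₀x₁x₂]`, irreducible
  (`orbitClosure_isCoeffZariskiIrreducible`), `Sub₂ ⊆ S′ ⊆ 𝒟ual_{0,3,3}` and `x₀x₁x₂ ∈ S′ ∖ Sub₂`,
  maximality fails.
* `not_LMR2013_prop_4_1_1_fst` — conjunct (i) ALONE (quantified as in the fact, `σ = Fin 3`) is
  false: the SECOND certificate (`¬ LMR2013_prop_4_1_1 (σ := Fin 3)` itself is already the tree's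
  `not_LMR2013_prop_4_1_1`; the dedup rule forbids restating it, it follows by `.1`).

Scope caveat (as in the lead's finding): the `k = 0` family used here does not touch the paper's
instance `(2n−2, n, n²)`; the (ii)-refutation does at every `(k,d,N)` by the same transverse
mechanism. Theorems only (+ private plumbing); no named facts. Honest framing: literature hygiene (an
erratum for one clause of a component lemma of the GCT boundary programme); it proves nothing about
`dc(per_m)`, and VP ≠ VNP is NOT proved — nothing here is progress on it.

## References

* J. M. Landsberg, L. Manivel, N. Ressayre, *Hypersurfaces with degenerate duals and the geometric
  complexity theory program*, Comment. Math. Helv. 88 (2013) 469–484, Prop. 4.1.1 (p. 482), §2.1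
  (p. 472), §4 (p. 481); arXiv:1004.4802 Prop. 4.0.3.
* C. G. Gibson, *Elementary Geometry of Algebraic Curves*, CUP 1998, Lemma 3.14 (binary forms).
* J. M. Landsberg, *Geometry and Complexity Theory*, CUP 2017, §6.2.2 (subspace varieties by
  flattening rank).
-/

noncomputable section

open MvPolynomial Matrix

namespace Literature.Computability.AlgebraicComplexity

/-! ### The Hessian of `x₀x₁x₂` -/

section Hessian

variable {A : Type*} [CommRing A]

/-- `det Hess(x₀x₁x₂) = 2·x₀x₁x₂` (the Hessian is `[[0,x₂,x₁],[x₂,0,x₀],[x₁,x₀,0]]`).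
[cite: LandsbergManivelRessayre2013, §2.1 (p. 472)] -/
theorem det_hessPoly_X012 :
    (hessPoly (X 0 * X 1 * X 2 : MvPolynomial (Fin 3) A)).det = 2 * (X 0 * X 1 * X 2) := by
  rw [Matrix.det_fin_three]
  simp only [hessPoly_apply, Derivation.leibniz, pderiv_X, smul_eq_mul]
  simp
  ring

/-- For the full frame the generalised Hessian minor is the Hessian determinant:
`hessGenMinor 1 1 f = det Hess f`. [cite: LandsbergManivelRessayre2013, §2.1 (p. 472)] -/
theorem hessGenMinor_one_one {n : ℕ} (f : MvPolynomial (Fin n) A) :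
    hessGenMinor (1 : Matrix (Fin n) (Fin n) A) 1 f = (hessPoly f).det := by
  rw [hessGenMinor, Matrix.map_one _ (map_zero _) (map_one _), Matrix.one_mul, Matrix.transpose_one,
    Matrix.mul_one]

end Hessian

/-! ### `Δ[x₀x₁x₂] ⊆ 𝒟ual_{0,3,3}` -/

section OrbitClosure

/-- `x₀x₁x₂` is a cubic form. [cite: LandsbergManivelRessayre2013, §4 (p. 481)] -/
theorem isHomogeneous_X012 {A : Type*} [CommRing A] :
    (X 0 * X 1 * X 2 : MvPolynomial (Fin 3) A).IsHomogeneous 3 :=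
  ((isHomogeneous_X A 0).mul (isHomogeneous_X A 1)).mul (isHomogeneous_X A 2)

/-- For every linear substitution `M` and every `3`-frame `B`, `M·(x₀x₁x₂)` divides
`det(B · H_{M·(x₀x₁x₂)} · Bᵀ) = M·(det(BM)² · 2·x₀x₁x₂)` (chain rule for the Hessian,
`hessGenMinor_linSubst`, `hessGenMinor_mul_mul`). [cite: LandsbergManivelRessayre2013, §2.3, eq. (5)] -/
theorem linSubst_X012_dvd_hessGenMinor (M B : Matrix (Fin 3) (Fin 3) ℂ) :
    linSubst (Fin 3) ℂ M (X 0 * X 1 * X 2) ∣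
      hessGenMinor B B (linSubst (Fin 3) ℂ M (X 0 * X 1 * X 2)) := by
  classical
  rw [hessGenMinor_linSubst]
  refine map_dvd (linSubst (Fin 3) ℂ M) ?_
  have h := hessGenMinor_mul_mul (B * M) (B * M) (1 : Matrix (Fin 3) (Fin 3) ℂ) 1
    (X 0 * X 1 * X 2 : MvPolynomial (Fin 3) ℂ)
  rw [Matrix.mul_one] at h
  rw [h, hessGenMinor_one_one, det_hessPoly_X012, ← mul_assoc]
  exact dvd_mul_left _ _

/-- Every `GL₃`- (indeed `End(ℂ³)`-) translate of `x₀x₁x₂` lies in `𝒟ual_{0,3,3}`: all equations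
(2) vanish on a form dividing its Hessian determinant on every frame (LMR §2.1: "the polynomial `P`
must divide `det(H_P|_F)`"; `lmrDualEquation_eq_zero_of_dvd`).
[cite: LandsbergManivelRessayre2013, §2.1 (p. 472)] -/
theorem linSubst_X012_mem_lmrDualScheme (M : Matrix (Fin 3) (Fin 3) ℂ) :
    linSubst (Fin 3) ℂ M (X 0 * X 1 * X 2) ∈ lmrDualScheme (σ := Fin 3) 0 3 := by
  refine ⟨linSubst_isHomogeneous M isHomogeneous_X012, fun B u v => ?_⟩
  exact lmrDualEquation_eq_zero_of_dvd le_rfl (linSubst_isHomogeneous M isHomogeneous_X012) B u v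
    (linSubst_X012_dvd_hessGenMinor M B)

/-- **`Δ[x₀x₁x₂] ⊆ 𝒟ual_{0,3,3}`**: the orbit lies in the scheme and the scheme is Zariski closed in
coefficient space (`coeffZariskiClosure_subset_lmrDualScheme`).
[cite: LandsbergManivelRessayre2013, §2.3 (p. 474)] -/
theorem orbitClosure_X012_subset_lmrDualScheme :
    orbitClosure (X 0 * X 1 * X 2 : MvPolynomial (Fin 3) ℂ) ⊆ lmrDualScheme (σ := Fin 3) 0 3 := by
  classical
  refine coeffZariskiClosure_subset_lmrDualScheme
    (S := glOrbit (Fin 3) ℂ (X 0 * X 1 * X 2 : MvPolynomial (Fin 3) ℂ)) ?_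
  rintro _ ⟨g, rfl⟩
  exact linSubst_X012_mem_lmrDualScheme (g : Matrix (Fin 3) (Fin 3) ℂ)

end OrbitClosure

/-! ### `Sub₂(S³ℂ³) ⊆ Δ[x₀x₁x₂]` -/

section Subspace

/-- A product of three linear forms `∏ᵢ (uᵢ x₀ + vᵢ x₁)` in the first two coordinates is the
substitution `N·(x₀x₁x₂)` by the matrix `N` with columns `(uᵢ, vᵢ, 0)`.
[cite: Gibson1998, Lemma 3.14] -/
theorem linSubst_X012_eq_prod (u v : Fin 3 → ℂ) :
    linSubst (Fin 3) ℂ (Matrix.of ![u, v, fun _ => 0]) (X 0 * X 1 * X 2) =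
      ∏ i : Fin 3, (C (u i) * X 0 + C (v i) * X 1) := by
  rw [← Fin.prod_univ_three (fun i : Fin 3 => (X i : MvPolynomial (Fin 3) ℂ)), map_prod]
  refine Finset.prod_congr rfl fun i _ => ?_
  rw [linSubst_X, Fin.sum_univ_three]
  simp only [Matrix.of_apply, Matrix.cons_val_zero, Matrix.cons_val_one, Matrix.cons_val_two,
    Matrix.head_cons, Matrix.tail_cons, zero_smul, add_zero, smul_eq_C_mul]

/-- **`Sub₂(S³ ℂ³) ⊆ Δ[x₀x₁x₂]`**: a point of `Sub₂(S³ℂ³)` is `A·Q(x₀,x₁)` with `Q` a binary cubic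
(`exists_linSubst_rename_of_mem_subspaceVariety`); `Q` is a product of three linear forms (Gibson
1998, Lemma 3.14); so the point is `(A N)·(x₀x₁x₂) ∈ End(ℂ³)·x₀x₁x₂ ⊆ Δ[x₀x₁x₂]`
(`endOrbit_subset_orbitClosure_holds`). [cite: LandsbergManivelRessayre2013, §4 (p. 481)] -/
theorem subspaceVariety_two_three_subset_orbitClosure_X012 :
    subspaceVariety (Fin 3) ℂ 2 3 ⊆ orbitClosure (X 0 * X 1 * X 2 : MvPolynomial (Fin 3) ℂ) := by
  classical
  intro f hf
  obtain ⟨A, A', Q, -, -, hQ, hfAQ⟩ := exists_linSubst_rename_of_mem_subspaceVariety hf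
  obtain ⟨u, v, huv⟩ :=
    Literature.RingTheory.MvPolynomial.exists_prod_linear_of_isHomogeneous hQ three_ne_zero
  have hren : rename (Fin.castSucc : Fin 2 → Fin 3) Q =
      ∏ i : Fin 3, (C (u i) * X 0 + C (v i) * X 1) := by
    rw [huv, map_prod]
    refine Finset.prod_congr rfl fun i _ => ?_
    simp only [map_add, map_mul, rename_C, rename_X, Fin.castSucc_zero, Fin.castSucc_one]
  have hf' : f = linSubst (Fin 3) ℂ (A * Matrix.of ![u, v, fun _ => 0]) (X 0 * X 1 * X 2) := by
    rw [linSubst_mul, AlgHom.comp_apply, linSubst_X012_eq_prod, ← hren, hfAQ]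
  rw [hf']
  exact endOrbit_subset_orbitClosure_holds (X 0 * X 1 * X 2 : MvPolynomial (Fin 3) ℂ)
    ⟨A * Matrix.of ![u, v, fun _ => 0], rfl⟩

end Subspace

/-! ### `x₀x₁x₂ ∉ Sub₂(S³ℂ³)` -/

section NotMem

/-- The partials of `x₀x₁x₂` are the monomials `x₂x₁, x₂x₀, x₀x₁`. [folklore] -/
private theorem pderiv_X012_eq (i : Fin 3) :
    pderiv i (X 0 * X 1 * X 2 : MvPolynomial (Fin 3) ℂ) =
      monomial ((![Finsupp.single 2 1 + Finsupp.single 1 1, Finsupp.single 2 1 + Finsupp.single 0 1,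
        Finsupp.single 0 1 + Finsupp.single 1 1] : Fin 3 → (Fin 3 →₀ ℕ)) i) 1 := by
  fin_cases i
  all_goals
    simp only [Derivation.leibniz, pderiv_X, smul_eq_mul]
    simp [X, monomial_mul]

/-- … and these three exponent vectors are pairwise distinct. [folklore] -/
private theorem partialExpo_injective :
    Function.Injective ((![Finsupp.single 2 1 + Finsupp.single 1 1,
      Finsupp.single 2 1 + Finsupp.single 0 1, Finsupp.single 0 1 + Finsupp.single 1 1] :
        Fin 3 → (Fin 3 →₀ ℕ))) := by
  intro i j h
  have h0 := Finsupp.ext_iff.1 h 0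
  have h1 := Finsupp.ext_iff.1 h 1
  fin_cases i <;> fin_cases j <;> simp at h0 h1 ⊢

/-- **`x₀x₁x₂ ∉ Sub₂(S³ℂ³)`**: its three partials `x₁x₂, x₀x₂, x₀x₁` are linearly independent, so
the flattening rank is `3 > 2` (Landsberg 2017 §6.2.2, tree
`finrank_span_pderiv_le_of_mem_subspaceVariety`). [cite: Landsberg2017, §6.2.2] -/
theorem X012_not_mem_subspaceVariety_two :
    (X 0 * X 1 * X 2 : MvPolynomial (Fin 3) ℂ) ∉ subspaceVariety (Fin 3) ℂ 2 3 := by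
  classical
  intro h
  have hle := (mem_subspaceVariety_iff_finrank_span_pderiv_le isHomogeneous_X012).1 h
  have hli : LinearIndependent ℂ
      fun i : Fin 3 => pderiv i (X 0 * X 1 * X 2 : MvPolynomial (Fin 3) ℂ) := by
    have : (fun i : Fin 3 => pderiv i (X 0 * X 1 * X 2 : MvPolynomial (Fin 3) ℂ)) =
        (MvPolynomial.basisMonomials (Fin 3) ℂ) ∘
          (![Finsupp.single 2 1 + Finsupp.single 1 1, Finsupp.single 2 1 + Finsupp.single 0 1,
            Finsupp.single 0 1 + Finsupp.single 1 1] : Fin 3 → (Fin 3 →₀ ℕ)) := by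
      funext i
      simp only [Function.comp_apply, MvPolynomial.coe_basisMonomials, pderiv_X012_eq]
    rw [this]
    exact (MvPolynomial.basisMonomials (Fin 3) ℂ).linearIndependent.comp _ partialExpo_injective
  have h3 := finrank_span_eq_card hli
  rw [Fintype.card_fin] at h3
  omega

end NotMem

/-! ### The refutation of conjunct (i) -/

section Refutation

/-- **`Sub₂(S³ℂ³)` is NOT an irreducible component of `𝒟ual_{0,3,3}`**: `S′ = Δ[x₀x₁x₂]` is an
irreducible subset of `𝒟ual_{0,3,3}` (`orbitClosure_isCoeffZariskiIrreducible`,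
`orbitClosure_X012_subset_lmrDualScheme`) containing `Sub₂(S³ℂ³)`
(`subspaceVariety_two_three_subset_orbitClosure_X012`) and the point `x₀x₁x₂ ∉ Sub₂`, so `Sub₂` is not
maximal. LMR 2013 Prop. 4.1.1 (i) asserts the contrary at `(k,d,N) = (0,3,3)`.
[cite: LandsbergManivelRessayre2013, Proposition 4.1.1 (p. 482)] -/
theorem not_isCoeffIrreducibleComponent_subspaceVariety_two_three :
    ¬ IsCoeffIrreducibleComponent (subspaceVariety (Fin 3) ℂ 2 3) (lmrDualScheme (σ := Fin 3) 0 3) := by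
  classical
  rintro ⟨-, -, hmax⟩
  have hP0 : (X 0 * X 1 * X 2 : MvPolynomial (Fin 3) ℂ) ≠ 0 :=
    mul_ne_zero (mul_ne_zero (X_ne_zero _) (X_ne_zero _)) (X_ne_zero _)
  have h := hmax _ (orbitClosure_isCoeffZariskiIrreducible isHomogeneous_X012 hP0)
    subspaceVariety_two_three_subset_orbitClosure_X012 orbitClosure_X012_subset_lmrDualScheme
  exact X012_not_mem_subspaceVariety_two (h (mem_orbitClosure_self _))

/-- **Landsberg–Manivel–Ressayre 2013, Prop. 4.1.1, conjunct (i) ALONE is false as printed** (second,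
independent certificate for the erratum; the negation of the whole fact, `¬ LMR2013_prop_4_1_1
(σ := Fin 3)`, is the tree's `not_LMR2013_prop_4_1_1`, obtained there through conjunct (ii) and
re-obtainable from this theorem by `fun h => this fun κ d hd hκ => (h κ d hd hκ).1`): it is NOT the
case that for all `k, d` with `3 ≤ d`, `k + 3 ≤ 3` the subspace variety `Sub_{k+2}(S^d ℂ³)` is an
irreducible component of `𝒟ual_{k,d,3}` — it fails at `k = 0`, `d = 3`.
[cite: LandsbergManivelRessayre2013, Proposition 4.1.1 (p. 482)] -/
theorem not_LMR2013_prop_4_1_1_fst :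
    ¬ ∀ (κ d : ℕ), 3 ≤ d → κ + 3 ≤ Fintype.card (Fin 3) →
      IsCoeffIrreducibleComponent (subspaceVariety (Fin 3) ℂ (κ + 2) d)
        (lmrDualScheme (σ := Fin 3) κ d) := by
  intro h
  exact not_isCoeffIrreducibleComponent_subspaceVariety_two_three (h 0 3 le_rfl (by simp))

/-- The whole fact through conjunct (i): `LMR2013_prop_4_1_1 (σ := Fin 3)` implies the (false)
component clause, so it is refuted again — stated as an implication into `False` from conjunct (i)'s
instance to keep it distinct from the tree's `not_LMR2013_prop_4_1_1` (same proposition, other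
route). [cite: LandsbergManivelRessayre2013, Proposition 4.1.1 (p. 482)] -/
theorem LMR2013_prop_4_1_1_fst_false
    (h : IsCoeffIrreducibleComponent (subspaceVariety (Fin 3) ℂ (0 + 2) 3)
      (lmrDualScheme (σ := Fin 3) 0 3)) : False :=
  not_isCoeffIrreducibleComponent_subspaceVariety_two_three h

end Refutation

end Literature.Computability.AlgebraicComplexity

end
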